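import Summits.BirchSwinnertonDyer.BirchSwinnertonDyer.Theorems.KimAtThreeDeepLowerExpStarOmegaPlace
import Summits.BirchSwinnertonDyer.BirchSwinnertonDyer.Theorems.KimAtThreeFineKatoSATPointsRat
import HarnessLib

/-!
# POS is well defined on the Kato stratum at `p = 3`: the valuation of a duality-normalising scalar of a Néron line
# does not depend on the scalar (crux `KatoKuriharaPortThreeShared`, stmt-BirchSwinnertonDyer-19560; cell `bsd-addord`,
# seat kim3 gen 15 = the crux's LEAD; `--supports 19560`, helper)

HONEST FRAMING.  TOOL theorems only (no definition, no named fact, no instance, no `sorry`); closes nothing; nothing is booked;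
BSD is not proved by any of this.

WHAT.  w2-acc4's position clause `POS(d, κ) := ∃ u : ℚ, u = κ ∧ ∀ hinj hex (e ≠ 0), hdual(e • d) → v₃(u) = v(ι e)`
(`KimAtThreeFineKatoOuterRescale.exists_dual_unit_of_position`) — the one conjunct of the 19560 residual that is OURS (the (a″)
reading: Manin constant / lattice optimality) — quantifies over EVERY duality-normalising scalar `e`.  On the stratum
(`Addv W 3`, `3 ∤ c₃`, `E(ℚ₃)[3] = 0`) the dual lattice `{a : ∀ Q, ‖a · log_ω Q‖ ≤ 1}` IS `ℤ₃` (kim3 g12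
`forall_norm_mul_padicLog_le_one_iff_three`), and `exp*_{e • d} = e⁻¹ · exp*_d` (w2-c2 `expStarOmega_smul`); hence two
duality-normalising scalars `e, e'` of the same line have `‖ι e‖ = ‖ι e'‖` (`norm_eq_of_hdual_smul`) and the same valuation
(`valuation_eq_of_hdual_smul`), so POS follows from ONE normalising scalar with the right valuation (`pos_of_exists`): the
successor proving (a″) exhibits one `e` (for Kato's line `c_P · ω_W`: `e = c_P⁻¹`) instead of arguing for all.
References: K. Kato, LNM 1553 (1993) Ch. II §1.2.4 [Kato1993LNM1553]; S. Bloch, K. Kato (1990) §3 Prop. 3.8 / Ex. 3.11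
[BlochKato1990]; C.-H. Kim (2022) Lemma 3.10 [Kim2022StructureSelmer].
-/

noncomputable section

-- the cell's Theorems namespace `Summit.BirchSwinnertonDyer.BirchSwinnertonDyer.…` repeats the summit name by design (D-0017)
set_option linter.dupNamespace false

open scoped NumberField Classical
open Field ValuativeRel IsDedekindDomain NumberField
open Literature.NumberTheory.GaloisRepresentations Literature.NumberTheory.GaloisRepresentations.PeriodRingData
open Literature.NumberTheory.PAdicHodge Literature.NumberTheory.EllipticCurves WeierstrassCurve
open Literature.NumberTheory.EllipticCurves.Rank1Residual
open Summit.BirchSwinnertonDyer.Rank1Residual.GaloisImage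
open Summit.BirchSwinnertonDyer.Rank1Residual.Additive.LocalLog
open Summit.BirchSwinnertonDyer.BirchSwinnertonDyer.Theorems.KimAtThreeDeepLowerExpStarOmega
open Summit.BirchSwinnertonDyer.BirchSwinnertonDyer.Theorems.KimAtThreeDeepLowerExpStarOmegaPlace
open Summit.BirchSwinnertonDyer.BirchSwinnertonDyer.Theorems.KimAtThreeFineKatoSATPointsRat

namespace Summit.BirchSwinnertonDyer.BirchSwinnertonDyer.Theorems.KimAtThreeFineKatoPositionUnit

variable (W : WeierstrassCurve ℚ) [W.IsElliptic] [W.IsGloballyMinimal]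
  (v : HeightOneSpectrum (𝓞 ℚ)) [hv : Fact (((3 : ℕ) : 𝓞 ℚ) ∈ v.asIdeal)]

omit [W.IsGloballyMinimal] in
/-- **Scale law in `ℚ_p`-currency**: `exp*_{e • d} = (ι e)⁻¹ · exp*_d` read through `ι : ℚ_v → ℚ_3` (place instances on `ℚ_v` as in
`KimAtThreeDeepLowerExpStarOmegaPlace`, inlined). [cite: Kato1993LNM1553, Ch. II §1.2.4] -/
theorem expStarOmegaPadicAt_smul (ι : Place.Completion (Sum.inr v : Place ℚ) →+* ℚ_[3]) :
    letI := valuativeRelPlace v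
    letI := topologicalSpacePlace v
    haveI := isNonarchimedeanLocalField_place v
    haveI := charZero_place v
    letI := padicAlgebraPlace 3 v
    haveI := fact_not_isUnit_place 3 v
    haveI := isAdicComplete_place 3 v
    ∀ (d : LocalNeronLineAt W 3 v)
      (hinj : (bdRPeriodRingData (valuation_place_lt_one 3 v)).CupLogInjective (logCyclotomic 3)
        (localRationalTateRep W 3 (galRestrictPlace v)))
      (hex : ∀ z : contOneCocycles (localRationalTateRep W 3 (galRestrictPlace v)).toTopRep,
        (bdRPeriodRingData (valuation_place_lt_one 3 v)).HasDualExp (logCyclotomic 3)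
          (localRationalTateRep W 3 (galRestrictPlace v)) fun σ => z.1 σ)
      (e : Place.Completion (Sum.inr v : Place ℚ)) (he : e ≠ 0)
      (y : (tateLocalRep W 3 (Sum.inr v)).cohomology 1),
      expStarOmegaPadicAt (d.smul e he) hinj hex ι y = (ι e)⁻¹ * expStarOmegaPadicAt d hinj hex ι y := by
  letI := valuativeRelPlace v
  letI := topologicalSpacePlace v
  haveI := isNonarchimedeanLocalField_place v
  haveI := charZero_place v
  letI := padicAlgebraPlace 3 v
  haveI := fact_not_isUnit_place 3 v
  haveI := isAdicComplete_place 3 v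
  intro d hinj hex e he y
  rw [expStarOmegaPadicAt_apply, expStarOmegaPadicAt_apply, ← map_inv₀, ← map_mul]
  exact congrArg ι (expStarOmega_smul _ _ d he y)

/-- **Two duality-normalising scalars of one Néron line have the same `3`-adic absolute value** (stratum `Addv W 3`,
`3 ∤ c₃`, `E(ℚ₃)[3] = 0`, where the dual lattice of `log_ω E(ℚ₃)` is `ℤ₃`): if `hdual(e • d)` and `hdual(e' • d)` then
`‖ι e‖ = ‖ι e'‖`. [cite: Kato1993LNM1553, Ch. II §1.2.4] [cite: Kim2022StructureSelmer, Lemma 3.10 (PDF p. 17)] -/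
theorem norm_eq_of_hdual_smul (hadd : Addv W 3) (hc : ¬ 3 ∣ (W.baseChange ℚ_[3]).localTamagawaNumber ℤ_[3])
    (ht : Nat.card {Q : (W.baseChange ℚ_[3]).toAffine.Point // (3 : ℕ) • Q = 0} = 1)
    (ι : Place.Completion (Sum.inr v : Place ℚ) →+* ℚ_[3]) :
    letI := valuativeRelPlace v
    letI := topologicalSpacePlace v
    haveI := isNonarchimedeanLocalField_place v
    haveI := charZero_place v
    letI := padicAlgebraPlace 3 v
    haveI := fact_not_isUnit_place 3 v
    haveI := isAdicComplete_place 3 v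
    ∀ (d : LocalNeronLineAt W 3 v)
      (hinj : (bdRPeriodRingData (valuation_place_lt_one 3 v)).CupLogInjective (logCyclotomic 3)
        (localRationalTateRep W 3 (galRestrictPlace v)))
      (hex : ∀ z : contOneCocycles (localRationalTateRep W 3 (galRestrictPlace v)).toTopRep,
        (bdRPeriodRingData (valuation_place_lt_one 3 v)).HasDualExp (logCyclotomic 3)
          (localRationalTateRep W 3 (galRestrictPlace v)) fun σ => z.1 σ)
      (e e' : Place.Completion (Sum.inr v : Place ℚ)) (he : e ≠ 0) (he' : e' ≠ 0),
      (∀ a : ℚ_[3], (∃ y, expStarOmegaPadicAt (d.smul e he) hinj hex ι y = a) ↔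
        ∀ Q : (W.baseChange ℚ_[3]).toAffine.Point, ‖a * padicLog (W.baseChange ℚ_[3]) Q‖ ≤ 1) →
      (∀ a : ℚ_[3], (∃ y, expStarOmegaPadicAt (d.smul e' he') hinj hex ι y = a) ↔
        ∀ Q : (W.baseChange ℚ_[3]).toAffine.Point, ‖a * padicLog (W.baseChange ℚ_[3]) Q‖ ≤ 1) →
      ‖ι e‖ = ‖ι e'‖ := by
  letI := valuativeRelPlace v
  letI := topologicalSpacePlace v
  haveI := isNonarchimedeanLocalField_place v
  haveI := charZero_place v
  letI := padicAlgebraPlace 3 v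
  haveI := fact_not_isUnit_place 3 v
  haveI := isAdicComplete_place 3 v
  intro d hinj hex
  -- `1` is in the dual lattice `ℤ₃`
  have h1 : ∀ Q : (W.baseChange ℚ_[3]).toAffine.Point, ‖(1 : ℚ_[3]) * padicLog (W.baseChange ℚ_[3]) Q‖ ≤ 1 :=
    (forall_norm_mul_padicLog_le_one_iff_three W hadd hc ht 1).mpr (by rw [norm_one])
  -- one-sided bound `‖ι f‖ ≤ ‖ι f'‖` from `hdual(f • d)` at `a = 1` and `hdual(f' • d)` at `a = ι f / ι f'`
  have key : ∀ (f f' : Place.Completion (Sum.inr v : Place ℚ)) (hf : f ≠ 0) (hf' : f' ≠ 0),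
      (∀ a : ℚ_[3], (∃ y, expStarOmegaPadicAt (d.smul f hf) hinj hex ι y = a) ↔
        ∀ Q : (W.baseChange ℚ_[3]).toAffine.Point, ‖a * padicLog (W.baseChange ℚ_[3]) Q‖ ≤ 1) →
      (∀ a : ℚ_[3], (∃ y, expStarOmegaPadicAt (d.smul f' hf') hinj hex ι y = a) ↔
        ∀ Q : (W.baseChange ℚ_[3]).toAffine.Point, ‖a * padicLog (W.baseChange ℚ_[3]) Q‖ ≤ 1) →
      ‖ι f‖ ≤ ‖ι f'‖ := by
    intro f f' hf hf' hF hF'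
    have hιf : ι f ≠ 0 := (map_ne_zero_iff _ ι.injective).mpr hf
    have hιf' : ι f' ≠ 0 := (map_ne_zero_iff _ ι.injective).mpr hf'
    obtain ⟨y, hy⟩ := (hF 1).mpr h1
    rw [expStarOmegaPadicAt_smul W v ι d hinj hex f hf y] at hy
    have hdy : expStarOmegaPadicAt d hinj hex ι y = ι f := by
      have := congrArg (fun t => ι f * t) hy
      simpa [mul_inv_cancel_left₀ hιf] using this
    have hmem : ∃ y', expStarOmegaPadicAt (d.smul f' hf') hinj hex ι y' = (ι f')⁻¹ * ι f :=
      ⟨y, by rw [expStarOmegaPadicAt_smul W v ι d hinj hex f' hf' y, hdy]⟩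
    have hle : ‖(ι f')⁻¹ * ι f‖ ≤ 1 :=
      (forall_norm_mul_padicLog_le_one_iff_three W hadd hc ht _).mp ((hF' _).mp hmem)
    rw [norm_mul, norm_inv] at hle
    have hpos : 0 < ‖ι f'‖ := norm_pos_iff.mpr hιf'
    calc ‖ι f‖ = ‖ι f'‖ * (‖ι f'‖⁻¹ * ‖ι f‖) := by rw [mul_inv_cancel_left₀ hpos.ne']
      _ ≤ ‖ι f'‖ * 1 := by gcongr
      _ = ‖ι f'‖ := mul_one _
  intro e e' he he' h h'
  exact le_antisymm (key e e' he he' h h') (key e' e he' he h' h)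

/-- **… hence the same `3`-adic valuation.** [cite: Kato1993LNM1553, Ch. II §1.2.4] [cite: Kim2022StructureSelmer, Lemma 3.10 (PDF p. 17)] -/
theorem valuation_eq_of_hdual_smul (hadd : Addv W 3) (hc : ¬ 3 ∣ (W.baseChange ℚ_[3]).localTamagawaNumber ℤ_[3])
    (ht : Nat.card {Q : (W.baseChange ℚ_[3]).toAffine.Point // (3 : ℕ) • Q = 0} = 1)
    (ι : Place.Completion (Sum.inr v : Place ℚ) →+* ℚ_[3]) :
    letI := valuativeRelPlace v
    letI := topologicalSpacePlace v
    haveI := isNonarchimedeanLocalField_place v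
    haveI := charZero_place v
    letI := padicAlgebraPlace 3 v
    haveI := fact_not_isUnit_place 3 v
    haveI := isAdicComplete_place 3 v
    ∀ (d : LocalNeronLineAt W 3 v)
      (hinj : (bdRPeriodRingData (valuation_place_lt_one 3 v)).CupLogInjective (logCyclotomic 3)
        (localRationalTateRep W 3 (galRestrictPlace v)))
      (hex : ∀ z : contOneCocycles (localRationalTateRep W 3 (galRestrictPlace v)).toTopRep,
        (bdRPeriodRingData (valuation_place_lt_one 3 v)).HasDualExp (logCyclotomic 3)
          (localRationalTateRep W 3 (galRestrictPlace v)) fun σ => z.1 σ)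
      (e e' : Place.Completion (Sum.inr v : Place ℚ)) (he : e ≠ 0) (he' : e' ≠ 0),
      (∀ a : ℚ_[3], (∃ y, expStarOmegaPadicAt (d.smul e he) hinj hex ι y = a) ↔
        ∀ Q : (W.baseChange ℚ_[3]).toAffine.Point, ‖a * padicLog (W.baseChange ℚ_[3]) Q‖ ≤ 1) →
      (∀ a : ℚ_[3], (∃ y, expStarOmegaPadicAt (d.smul e' he') hinj hex ι y = a) ↔
        ∀ Q : (W.baseChange ℚ_[3]).toAffine.Point, ‖a * padicLog (W.baseChange ℚ_[3]) Q‖ ≤ 1) →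
      (ι e).valuation = (ι e').valuation := by
  letI := valuativeRelPlace v
  letI := topologicalSpacePlace v
  haveI := isNonarchimedeanLocalField_place v
  haveI := charZero_place v
  letI := padicAlgebraPlace 3 v
  haveI := fact_not_isUnit_place 3 v
  haveI := isAdicComplete_place 3 v
  intro d hinj hex e e' he he' h h'
  have hιe : ι e ≠ 0 := (map_ne_zero_iff _ ι.injective).mpr he
  have hιe' : ι e' ≠ 0 := (map_ne_zero_iff _ ι.injective).mpr he'
  have hn := norm_eq_of_hdual_smul W v hadd hc ht ι d hinj hex e e' he he' h h'
  rw [Padic.norm_eq_zpow_neg_valuation hιe, Padic.norm_eq_zpow_neg_valuation hιe'] at hn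
  have h3 : (1 : ℝ) < ((3 : ℕ) : ℝ) := by norm_num
  have := zpow_right_injective₀ (by positivity) h3.ne' hn
  linarith

/-- **POS from ONE normalising scalar**: on the stratum, if SOME duality-normalising `e • d` has `v₃(u) = v(ι e)`, then EVERY
duality-normalising scalar of `d` does — the `∀ hinj hex e he, hdual(e • d) → …` clause of w2-acc4's POS
(`KimAtThreeFineKatoOuterRescale.exists_dual_unit_of_position`). [cite: Kato1993LNM1553, Ch. II §1.2.4]
[cite: Kim2022StructureSelmer, Lemma 3.10 (PDF p. 17)] -/
theorem pos_of_exists (hadd : Addv W 3) (hc : ¬ 3 ∣ (W.baseChange ℚ_[3]).localTamagawaNumber ℤ_[3])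
    (ht : Nat.card {Q : (W.baseChange ℚ_[3]).toAffine.Point // (3 : ℕ) • Q = 0} = 1)
    (ι : Place.Completion (Sum.inr v : Place ℚ) →+* ℚ_[3]) (u : ℚ) :
    letI := valuativeRelPlace v
    letI := topologicalSpacePlace v
    haveI := isNonarchimedeanLocalField_place v
    haveI := charZero_place v
    letI := padicAlgebraPlace 3 v
    haveI := fact_not_isUnit_place 3 v
    haveI := isAdicComplete_place 3 v
    ∀ (d : LocalNeronLineAt W 3 v),
      (∃ (hinj : (bdRPeriodRingData (valuation_place_lt_one 3 v)).CupLogInjective (logCyclotomic 3)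
        (localRationalTateRep W 3 (galRestrictPlace v)))
      (hex : ∀ z : contOneCocycles (localRationalTateRep W 3 (galRestrictPlace v)).toTopRep,
        (bdRPeriodRingData (valuation_place_lt_one 3 v)).HasDualExp (logCyclotomic 3)
          (localRationalTateRep W 3 (galRestrictPlace v)) fun σ => z.1 σ)
        (e : Place.Completion (Sum.inr v : Place ℚ)) (he : e ≠ 0),
        (∀ a : ℚ_[3], (∃ y, expStarOmegaPadicAt (d.smul e he) hinj hex ι y = a) ↔
        ∀ Q : (W.baseChange ℚ_[3]).toAffine.Point, ‖a * padicLog (W.baseChange ℚ_[3]) Q‖ ≤ 1) ∧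
        padicValRat 3 u = (ι e).valuation) →
      ∀ (hinj : (bdRPeriodRingData (valuation_place_lt_one 3 v)).CupLogInjective (logCyclotomic 3)
        (localRationalTateRep W 3 (galRestrictPlace v)))
      (hex : ∀ z : contOneCocycles (localRationalTateRep W 3 (galRestrictPlace v)).toTopRep,
        (bdRPeriodRingData (valuation_place_lt_one 3 v)).HasDualExp (logCyclotomic 3)
          (localRationalTateRep W 3 (galRestrictPlace v)) fun σ => z.1 σ)
        (e : Place.Completion (Sum.inr v : Place ℚ)) (he : e ≠ 0),
        (∀ a : ℚ_[3], (∃ y, expStarOmegaPadicAt (d.smul e he) hinj hex ι y = a) ↔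
        ∀ Q : (W.baseChange ℚ_[3]).toAffine.Point, ‖a * padicLog (W.baseChange ℚ_[3]) Q‖ ≤ 1) →
        padicValRat 3 u = (ι e).valuation := by
  letI := valuativeRelPlace v
  letI := topologicalSpacePlace v
  haveI := isNonarchimedeanLocalField_place v
  haveI := charZero_place v
  letI := padicAlgebraPlace 3 v
  haveI := fact_not_isUnit_place 3 v
  haveI := isAdicComplete_place 3 v
  intro d hone hinj hex e he h
  obtain ⟨hinj₀, hex₀, e₀, he₀, h₀, hu⟩ := hone
  rw [hu]
  exact valuation_eq_of_hdual_smul W v hadd hc ht ι d hinj hex e₀ e he₀ he h₀ h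

end Summit.BirchSwinnertonDyer.BirchSwinnertonDyer.Theorems.KimAtThreeFineKatoPositionUnit

end
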